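import Literature.AlgebraicGeometry.HodgeTheory.CMHodgeGroupCentreWeil
import Literature.AlgebraicGeometry.Motives.HodgeLieRigid
import HarnessLib

/-!
# `Lie Hg ⊆ 𝔰𝔲_K` at the level of Hodge structures: a skew Hodge endomorphism `y` trace-orthogonal to the Hodge operator
# is trace-orthogonal to all of `Lie Hg` (Moonen–Zarhin (3.1) rigidity), so its weighted block traces vanish on `Lie Hg ⊗ ℂ`
# (Moonen–Zarhin 1998 §4 Remark (1): `Hdg ⊂ SU_K` when `W_K` consists of Hodge classes)

Family `hodge`, layer `Literature/AlgebraicGeometry/HodgeTheory` (cell `pub-hodgeav-hg6`, req-37 (A) Q2b, TABLE X ROW 11 =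
`IV(2,1).kE0`, design note `HOME/jobs/ROW11-Esquare-eng4g8/DESIGN.md`, brick R11-2 «K-trace»). UNCONDITIONAL; theorems only, no
definition, no named fact, no `sorry`. HONEST FRAMING of that cell: HC / HC_AV / HC_CM / H2 NOT proved — linear algebra of
polarized weight-one `ℚ`-Hodge structures; nothing here is a statement about algebraic cycles.

SETTING (eng-5 lineage's `CMTheta*` vocabulary): `H` effective polarized of weight `1`, `ψ` a polarization, `E = End_Hdg(V) =
ℚ[φ]` (`hE`), a CM type `μ : ι → ℂ` of `φ_ℂ` with blocks `W_{μ k}` of dimension `n₀` (`hrank`) spanning `V_ℂ` with their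
conjugates (`htop`); `y ∈ E` `ψ`-skew acting on `W_{μ k}` by the scalar `σ_k`.
* §1 `CMThetaKWeil.mem_spanC_inf_ker` — descent for ONE rational linear condition: an element of `𝔥_ℂ` killed by the
  complexification of a rational functional `f` lies in `(𝔥 ∩ ker f)_ℂ` (elementary: split off one vector of `𝔥` outside
  `ker f`).
* §2 **`CMThetaKWeil.trace_mul_eq_zero_of_mem_hodgeLie`** — if `Σ_k σ_k · (dim W_{μ k}^{1,0} − dim W_{μ k}^{0,1}) = 0`, i.e.
  `Tr(y_ℂ Θ) = 0` (`CMThetaCentre.trace_baseChange_mul_theta`), then `Tr(y X) = 0` for EVERY `X ∈ Lie Hg(H)`: the subspace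
  `{X ∈ Lie Hg : Tr(yX) = 0}` is rational, bracket-closed (`y` commutes with `Lie Hg`) and its complex span contains `Θ` (§1),
  so it is all of `Lie Hg` by rigidity (`hodgeLie_rigid`, Moonen–Zarhin (3.1)). For `y = φ_K` generating an imaginary
  quadratic `K ⊂ E` with `W_K := ker(φ_{K,ℂ} − ν) = ⊕_{k : σ_k = ν} W_{μ k}` this hypothesis is the `K`-Weil balance
  `dim W_K^{1,0} = dim W_K^{0,1}`, and the conclusion is «`Lie Hg ⊆ 𝔰𝔲_K(V, ψ)`» (§3) — obtained here WITHOUT the Hodge group,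
  determinants or `⋀_K`.
* §3 **`CMThetaKWeil.sum_mul_trace_restrict_eq_zero`** — for any admissible `𝔤` (commuting with `E`, `ψ`-skew) trace-orthogonal
  to `y` (`Tr(yX) = 0` on `𝔤`; §2 for `𝔤 = Lie Hg`), every `D ∈ 𝔤_ℂ` has `Σ_k σ_k · tr(D|_{W_{μ k}}) = 0`
  (`CMArith.trace_mul_eq_two_mul_sum`); **`CMThetaKWeil.trace_restrict_add_eq_zero`** — two places `k₁ ≠ k₂` covering `ι` on
  which `y` acts by the SAME non-zero scalar (the `K`-fibre is the CM type): `tr(D|_{W_{μ k₁}}) + tr(D|_{W_{μ k₂}}) = 0`;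
  **`CMThetaKWeil.trace_restrict_add_eq_zero_of_mem_hodgeLieC`** — the same for `𝔤 = Lie Hg`, unconditionally, under the
  `K`-Weil balance `(p₁ − q₁) + (p₂ − q₂) = 0` (e.g. the pattern `(2,1)+(1,2)` of TABLE X row 11).

## References
* [MoonenZarhin1999LowDim] B. Moonen, Yu. Zarhin, Math. Ann. 315 (1999), §3 (3.1) (rigidity), §2 (2.3).
* [MoonenZarhin1998WeilClasses] B. Moonen, Yu. Zarhin, J. reine angew. Math. 496 (1998), §4 Remark (1).
* [Deligne1982HodgeCycles] P. Deligne, LNM 900 (1982), I §3 (proof of Prop. 3.4: the Lie algebra is defined over `ℚ`), §4.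
-/

noncomputable section

open scoped TensorProduct
open Module

namespace Literature.AlgebraicGeometry.Motives

namespace HodgeStructure

universe u

variable {V : Type u} [AddCommGroup V] [Module ℚ V] {n : ℤ}

/-! ### §1 Descent for one rational linear condition -/

/-- **Descent for one rational condition.** `𝔥 ⊆ End_ℚ(V)` a subspace, `f` a rational linear functional and `g` a complex
linear functional on `End_ℂ(V_ℂ)` with `g(X_ℂ) = f(X)` on `𝔥`. Then every `D ∈ 𝔥_ℂ` with `g(D) = 0` lies in `(𝔥 ∩ ker f)_ℂ`:
if `f` vanishes on `𝔥` there is nothing to do; otherwise `𝔥 = (𝔥 ∩ ker f) ⊕ ℚX₀` with `f(X₀) ≠ 0`, so `D = A + c X₀,ℂ` with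
`A ∈ (𝔥 ∩ ker f)_ℂ`, and `0 = g(D) = c f(X₀)` forces `c = 0`. (Deligne I §3: the relevant subspaces are defined over `ℚ`.)
[cite: Deligne1982HodgeCycles, I §3 (proof of Prop. 3.4)] -/
theorem CMThetaKWeil.mem_spanC_inf_ker {𝔥 : Submodule ℚ (Module.End ℚ V)} (f : Module.End ℚ V →ₗ[ℚ] ℚ)
    (g : Module.End ℂ (ℂ ⊗[ℚ] V) →ₗ[ℂ] ℂ) (hfg : ∀ X ∈ 𝔥, g (X.baseChange ℂ) = (f X : ℂ))
    {D : Module.End ℂ (ℂ ⊗[ℚ] V)} (hD : D ∈ spanC 𝔥) (hgD : g D = 0) : D ∈ spanC (𝔥 ⊓ LinearMap.ker f) := by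
  -- `g` vanishes on `(𝔥 ∩ ker f)_ℂ`
  have hg0 : ∀ A ∈ spanC (𝔥 ⊓ LinearMap.ker f), g A = 0 := by
    intro A hA
    unfold spanC at hA
    induction hA using Submodule.span_induction with
    | mem A hA =>
      obtain ⟨X, hX, rfl⟩ := hA
      rw [hfg X hX.1, LinearMap.mem_ker.1 hX.2, Rat.cast_zero]
    | zero => rw [map_zero]
    | add A A' _ _ h h' => rw [map_add, h, h', add_zero]
    | smul c A _ h => rw [map_smul, h, smul_zero]
  by_cases hf : ∀ X ∈ 𝔥, f X = 0
  · have heq : 𝔥 ⊓ LinearMap.ker f = 𝔥 := inf_eq_left.2 fun X hX => LinearMap.mem_ker.2 (hf X hX)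
    rw [heq]; exact hD
  push Not at hf
  obtain ⟨X₀, hX₀, hfX₀⟩ := hf
  -- `𝔥_ℂ ≤ (𝔥 ∩ ker f)_ℂ + ℂ X₀,ℂ`
  have hle : spanC 𝔥 ≤ spanC (𝔥 ⊓ LinearMap.ker f) ⊔ (ℂ ∙ X₀.baseChange ℂ) := by
    unfold spanC
    refine Submodule.span_le.2 ?_
    rintro _ ⟨X, hX, rfl⟩
    have hsplit : X.baseChange ℂ = (X - (f X / f X₀) • X₀).baseChange ℂ + ((f X / f X₀ : ℚ) : ℂ) • X₀.baseChange ℂ := by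
      rw [LinearMap.baseChange_sub, LinearMap.baseChange_smul, ← algebraMap_smul ℂ (f X / f X₀) (X₀.baseChange ℂ),
        eq_ratCast, sub_add_cancel]
    change X.baseChange ℂ ∈ _
    rw [hsplit]
    refine Submodule.add_mem _ (Submodule.mem_sup_left (Submodule.subset_span ⟨_, ⟨Submodule.sub_mem _ hX
      (Submodule.smul_mem _ _ hX₀), ?_⟩, rfl⟩)) (Submodule.mem_sup_right (Submodule.smul_mem _ _
      (Submodule.mem_span_singleton_self _)))
    rw [SetLike.mem_coe, LinearMap.mem_ker, map_sub, map_smul, smul_eq_mul, div_mul_cancel₀ _ hfX₀, sub_self]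
  obtain ⟨A, hA, B, hB, hAB⟩ := Submodule.mem_sup.1 (hle hD)
  obtain ⟨c, rfl⟩ := Submodule.mem_span_singleton.1 hB
  have hc : c = 0 := by
    have h := hgD
    rw [← hAB, map_add, hg0 A hA, zero_add, map_smul, hfg X₀ hX₀, smul_eq_mul] at h
    exact (mul_eq_zero.1 h).resolve_right (by exact_mod_cast hfX₀)
  rw [← hAB, hc, zero_smul, add_zero]
  exact hA

/-! ### §2 A skew Hodge endomorphism trace-orthogonal to `Θ` is trace-orthogonal to `Lie Hg` -/

/-- **`Tr(y_ℂ Θ) = 0 ⟹ Tr(y X) = 0` on `Lie Hg`** (see the module docstring): `H` effective polarized of weight `1`, `E = ℚ[φ]`,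
`μ` a CM type spanning `V_ℂ`, `y ∈ E` `ψ`-skew acting on `W_{μ k}` by `σ_k`, and `Σ_k σ_k (dim W_{μ k}^{1,0} − dim W_{μ k}^{0,1}) = 0`.
Then `Tr(y X) = 0` for every `X ∈ Lie Hg(H)` — by rigidity (`hodgeLie_rigid`) applied to the rational bracket-closed
`{X ∈ Lie Hg : Tr(yX) = 0}`, whose complex span contains `Θ` (§1 with `CMThetaCentre.trace_baseChange_mul_theta`).
[cite: MoonenZarhin1999LowDim, §3 (3.1)] [cite: MoonenZarhin1998WeilClasses, §4 Remark (1)]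
[cite: Deligne1982HodgeCycles, I §3 (proof of Prop. 3.4)] -/
theorem CMThetaKWeil.trace_mul_eq_zero_of_mem_hodgeLie [Module.Finite ℚ V] [HodgeTensorFacts.{u, u}] {ι : Type} [Fintype ι]
    [DecidableEq ι] (H : HodgeStructure V n) (hn : n = 1) (heff : H.IsEffective) (ψ : H.Polarization)
    {φ : Module.End ℚ V} (hφE : φ ∈ H.endAlg) {m : ℕ} (hE : ∀ a ∈ H.endAlg, ∃ q : Fin m → ℚ, a = ∑ k, q k • φ ^ (k : ℕ))
    (μ : ι → ℂ) (hinj : Function.Injective μ) (hdist : ∀ k k', μ k' ≠ starRingEnd ℂ (μ k)) {n₀ : ℕ}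
    (hrank : ∀ k, Module.finrank ℂ ↥(Module.End.eigenspace (φ.baseChange ℂ) (μ k) ⊓ H.piece 1 0) +
      Module.finrank ℂ ↥(Module.End.eigenspace (φ.baseChange ℂ) (μ k) ⊓ H.piece 0 1) = n₀)
    (htop : (⨆ kt : ι × Fin 2, Module.End.eigenspace (φ.baseChange ℂ)
      (if kt.2 = 0 then μ kt.1 else starRingEnd ℂ (μ kt.1))) = ⊤)
    {y : Module.End ℚ V} (hyE : y ∈ H.endAlg) (hyskew : ∀ v w, ψ.form (y v) w + ψ.form v (y w) = 0) (σ : ι → ℂ)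
    (hσ : ∀ k, ∀ w ∈ Module.End.eigenspace (φ.baseChange ℂ) (μ k), y.baseChange ℂ w = σ k • w)
    (hbal : ∑ k, σ k * (((Module.finrank ℂ ↥(Module.End.eigenspace (φ.baseChange ℂ) (μ k) ⊓ H.piece 1 0)) : ℂ) -
      (Module.finrank ℂ ↥(Module.End.eigenspace (φ.baseChange ℂ) (μ k) ⊓ H.piece 0 1) : ℂ)) = 0) :
    ∀ X ∈ H.hodgeLie, LinearMap.trace ℚ V (y * X) = 0 := by
  classical
  haveI : Module.Free ℚ V := Module.Free.of_divisionRing ℚ V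
  -- the functionals `f(X) = Tr(yX)` and `g(D) = Tr(y_ℂ D)`
  set f : Module.End ℚ V →ₗ[ℚ] ℚ := LinearMap.trace ℚ V ∘ₗ LinearMap.mulLeft ℚ y with hfdef
  have hf : ∀ X, f X = LinearMap.trace ℚ V (y * X) := fun X => rfl
  set g : Module.End ℂ (ℂ ⊗[ℚ] V) →ₗ[ℂ] ℂ := LinearMap.trace ℂ _ ∘ₗ LinearMap.mulLeft ℂ (y.baseChange ℂ) with hgdef
  have hg : ∀ D, g D = LinearMap.trace ℂ _ (y.baseChange ℂ * D) := fun D => rfl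
  have hfg : ∀ X ∈ H.hodgeLie, g (X.baseChange ℂ) = (f X : ℂ) := fun X _ => by
    rw [hg, hf, ← LinearMap.baseChange_mul, LinearMap.trace_baseChange, eq_ratCast]
  -- the rational bracket-closed subspace `𝔞 = {X ∈ Lie Hg : Tr(yX) = 0}`
  set 𝔞 : Submodule ℚ (Module.End ℚ V) := H.hodgeLie ⊓ LinearMap.ker f with h𝔞
  have hbr : ∀ X ∈ 𝔞, ∀ X' ∈ 𝔞, X * X' - X' * X ∈ 𝔞 := by
    intro X hX X' hX'
    refine ⟨H.commutator_mem_hodgeLie hX.1 hX'.1, LinearMap.mem_ker.2 ?_⟩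
    have hyX' : X' * y = y * X' := H.commute_of_mem_hodgeLie hX'.1 ⟨y, hyE⟩
    rw [hf, mul_sub, map_sub, ← mul_assoc, ← mul_assoc, ← hyX', mul_assoc X' y X, LinearMap.trace_mul_comm ℚ X',
      mul_assoc, sub_self]
  -- `Θ ∈ 𝔞_ℂ`
  obtain ⟨Θ, hΘ⟩ := exists_hodgeTheta H
  have hΘC : Θ ∈ H.hodgeLieC := H.mem_hodgeLieC_of_forall_piece hΘ
  have hΘφ : Θ * φ.baseChange ℂ = φ.baseChange ℂ * Θ := H.commute_baseChange_of_mem_hodgeLieC hΘC ⟨φ, hφE⟩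
  have hΘskew : ∀ x z, ψ.form.baseChange ℂ (Θ x) z + ψ.form.baseChange ℂ x (Θ z) = 0 := fun x z => by
    rw [formBaseChange_skew_of_mem_hodgeLieC ψ hΘC x z, neg_add_cancel]
  have hgΘ : g Θ = 0 := by
    rw [hg, CMThetaCentre.trace_baseChange_mul_theta H hn heff ψ hφE hE μ hinj hdist hrank htop hΘ hΘφ hΘskew hyskew σ hσ,
      hbal, mul_zero]
  have hΘ𝔞 : Θ ∈ spanC 𝔞 := by
    rw [h𝔞]
    exact CMThetaKWeil.mem_spanC_inf_ker f g hfg ((hodgeLieC_eq_spanC H) ▸ hΘC) hgΘ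
  -- rigidity
  have hle : H.hodgeLie ≤ 𝔞 := hodgeLie_rigid H ⟨ψ⟩ 𝔞 inf_le_left hbr ⟨Θ, hΘ𝔞, hΘ⟩
  intro X hX
  rw [← hf]
  exact LinearMap.mem_ker.1 (hle hX).2

/-! ### §3 Weighted block traces vanish on `𝔤_ℂ` -/

/-- **`Σ_k σ_k · tr(D|_{W_{μ k}}) = 0` on `𝔤_ℂ` for `𝔤` trace-orthogonal to `y`.** `H` effective polarized of weight `1`,
`E = ℚ[φ]`, `μ` a CM type (blocks of dimension `n₀`, spanning `V_ℂ` with their conjugates), `y ∈ E` `ψ`-skew acting on `W_{μ k}` by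
`σ_k`, `𝔤` admissible (commuting with `E`, `ψ`-skew) with `Tr(yX) = 0` for all `X ∈ 𝔤` (for `𝔤 = Lie Hg`: §2). Then for every
`D ∈ 𝔤_ℂ` the weighted sum of block traces `Σ_k σ_k · tr(D|_{W_{μ k}})` vanishes (`0 = Tr(y_ℂ D) = 2 Σ_k σ_k tr(D|_{W_{μ k}})`,
`CMArith.trace_mul_eq_two_mul_sum` in an adapted dual basis). [cite: MoonenZarhin1998WeilClasses, §4 Remark (1)]
[cite: MoonenZarhin1999LowDim, §2 (2.3)] [cite: Deligne1982HodgeCycles, §4 (p. 30)] -/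
theorem CMThetaKWeil.sum_mul_trace_restrict_eq_zero [Module.Finite ℚ V] [HodgeTensorFacts.{u, u}] {ι : Type} [Fintype ι]
    [DecidableEq ι] (H : HodgeStructure V n) (hn : n = 1) (heff : H.IsEffective) (ψ : H.Polarization)
    {φ : Module.End ℚ V} (hφE : φ ∈ H.endAlg) {m : ℕ} (hE : ∀ a ∈ H.endAlg, ∃ q : Fin m → ℚ, a = ∑ k, q k • φ ^ (k : ℕ))
    (μ : ι → ℂ) (hinj : Function.Injective μ) (hdist : ∀ k k', μ k' ≠ starRingEnd ℂ (μ k)) {n₀ : ℕ}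
    (hrank : ∀ k, Module.finrank ℂ ↥(Module.End.eigenspace (φ.baseChange ℂ) (μ k) ⊓ H.piece 1 0) +
      Module.finrank ℂ ↥(Module.End.eigenspace (φ.baseChange ℂ) (μ k) ⊓ H.piece 0 1) = n₀)
    (htop : (⨆ kt : ι × Fin 2, Module.End.eigenspace (φ.baseChange ℂ)
      (if kt.2 = 0 then μ kt.1 else starRingEnd ℂ (μ kt.1))) = ⊤)
    {y : Module.End ℚ V} (hyskew : ∀ v w, ψ.form (y v) w + ψ.form v (y w) = 0) (σ : ι → ℂ)
    (hσ : ∀ k, ∀ w ∈ Module.End.eigenspace (φ.baseChange ℂ) (μ k), y.baseChange ℂ w = σ k • w)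
    (𝔤 : Submodule ℚ (Module.End ℚ V))
    (hcomm : ∀ X ∈ 𝔤, ∀ a : H.endAlg, X * (a : Module.End ℚ V) = (a : Module.End ℚ V) * X)
    (hskew : ∀ X ∈ 𝔤, ∀ v w, ψ.form (X v) w + ψ.form v (X w) = 0)
    (hy𝔤 : ∀ X ∈ 𝔤, LinearMap.trace ℚ V (y * X) = 0)
    {D : Module.End ℂ (ℂ ⊗[ℚ] V)} (hD : D ∈ spanC 𝔤) :
    ∑ k, σ k * LinearMap.trace ℂ _ (D.restrict fun x (hx : x ∈ Module.End.eigenspace (φ.baseChange ℂ) (μ k)) =>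
      UnitaryTheta.apply_mem_eigenspace_of_commute (UnitaryTheta.commute_of_mem_spanC H hφE hcomm hD) hx) = 0 := by
  classical
  obtain ⟨cb, κ, hcbW, -, -, -, hdual, hiso⟩ :=
    CMTheta.exists_adaptedDualBasis H hn heff ψ hφE hE μ hinj hdist hrank htop
  have hfin : ∀ k, Module.finrank ℂ ↥(Module.End.eigenspace (φ.baseChange ℂ) (μ k)) = n₀ := fun k => by
    rw [CMTheta.finrank_eigenspace_eq_add H hn heff hφE, hrank k]
  have hDφ : D * φ.baseChange ℂ = φ.baseChange ℂ * D := UnitaryTheta.commute_of_mem_spanC H hφE hcomm hD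
  have hDW : ∀ k, ∀ w ∈ Module.End.eigenspace (φ.baseChange ℂ) (μ k), D w ∈ Module.End.eigenspace (φ.baseChange ℂ) (μ k) :=
    fun k w hw => UnitaryTheta.apply_mem_eigenspace_of_commute hDφ hw
  have hDskew : ∀ x z, ψ.form.baseChange ℂ (D x) z + ψ.form.baseChange ℂ x (D z) = 0 := fun x z =>
    ThetaSubalgebra.formBaseChange_add_eq_zero_of_mem_spanC ψ hskew hD x z
  have he0 : ∀ k : ι, Function.Injective (fun j : Fin n₀ => (((k, (0 : Fin 2)), j) : (ι × Fin 2) × Fin n₀)) :=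
    fun k j j' h => by simpa using h
  have htr := CMThetaCentre.trace_mul_eq_zero_of_mem_spanC hy𝔤 hD
  rw [CMArith.trace_mul_eq_two_mul_sum cb (ψ.form.baseChange ℂ) hdual hiso _ D σ (fun k j => hσ k _ (hcbW k j))
    (CMThetaCentre.baseChange_skew H ψ hyskew) hDskew (fun k j => hσ k _ (hDW k _ (hcbW k j)))] at htr
  have h2 : ∑ k, σ k * ∑ j, cb.repr (D (cb ((k, 0), j))) ((k, 0), j) = 0 :=
    (mul_eq_zero.1 htr).resolve_left two_ne_zero
  rw [← h2]
  refine Finset.sum_congr rfl fun k _ => ?_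
  rw [← CMArith.trace_restrict_eq_sum_repr cb _ (he0 k) _ (hcbW k) (hfin k) D (hDW k)]

/-- **`tr(D|_{W_{μ k₁}}) + tr(D|_{W_{μ k₂}}) = 0` on `𝔤_ℂ`** when `ι = {k₁, k₂}` and `y` acts on BOTH blocks of the CM type by the
same non-zero scalar `ν` (`y = φ_K` with the `K`-fibre equal to the CM type) and `𝔤` is trace-orthogonal to `y` (§3).
This is «`𝔤 ⊗ ℂ ⊆ 𝔰𝔲_K(V, ψ) ⊗ ℂ`» read on the `K`-eigenspace `W_K = W_{μ k₁} ⊕ W_{μ k₂}`.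
[cite: MoonenZarhin1998WeilClasses, §4 Remark (1)] [cite: MoonenZarhin1999LowDim, §2 (2.3)] -/
theorem CMThetaKWeil.trace_restrict_add_eq_zero [Module.Finite ℚ V] [HodgeTensorFacts.{u, u}] {ι : Type} [Fintype ι]
    [DecidableEq ι] (H : HodgeStructure V n) (hn : n = 1) (heff : H.IsEffective) (ψ : H.Polarization)
    {φ : Module.End ℚ V} (hφE : φ ∈ H.endAlg) {m : ℕ} (hE : ∀ a ∈ H.endAlg, ∃ q : Fin m → ℚ, a = ∑ k, q k • φ ^ (k : ℕ))
    (μ : ι → ℂ) (hinj : Function.Injective μ) (hdist : ∀ k k', μ k' ≠ starRingEnd ℂ (μ k)) {n₀ : ℕ}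
    (hrank : ∀ k, Module.finrank ℂ ↥(Module.End.eigenspace (φ.baseChange ℂ) (μ k) ⊓ H.piece 1 0) +
      Module.finrank ℂ ↥(Module.End.eigenspace (φ.baseChange ℂ) (μ k) ⊓ H.piece 0 1) = n₀)
    (htop : (⨆ kt : ι × Fin 2, Module.End.eigenspace (φ.baseChange ℂ)
      (if kt.2 = 0 then μ kt.1 else starRingEnd ℂ (μ kt.1))) = ⊤)
    {y : Module.End ℚ V} (hyskew : ∀ v w, ψ.form (y v) w + ψ.form v (y w) = 0) {ν : ℂ} (hν : ν ≠ 0)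
    (hyν : ∀ k, ∀ w ∈ Module.End.eigenspace (φ.baseChange ℂ) (μ k), y.baseChange ℂ w = ν • w)
    (k₁ k₂ : ι) (hk : k₁ ≠ k₂) (hι : ∀ k, k = k₁ ∨ k = k₂)
    (𝔤 : Submodule ℚ (Module.End ℚ V))
    (hcomm : ∀ X ∈ 𝔤, ∀ a : H.endAlg, X * (a : Module.End ℚ V) = (a : Module.End ℚ V) * X)
    (hskew : ∀ X ∈ 𝔤, ∀ v w, ψ.form (X v) w + ψ.form v (X w) = 0)
    (hy𝔤 : ∀ X ∈ 𝔤, LinearMap.trace ℚ V (y * X) = 0)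
    {D : Module.End ℂ (ℂ ⊗[ℚ] V)} (hD : D ∈ spanC 𝔤) :
    LinearMap.trace ℂ _ (D.restrict fun x (hx : x ∈ Module.End.eigenspace (φ.baseChange ℂ) (μ k₁)) =>
        UnitaryTheta.apply_mem_eigenspace_of_commute (UnitaryTheta.commute_of_mem_spanC H hφE hcomm hD) hx) +
      LinearMap.trace ℂ _ (D.restrict fun x (hx : x ∈ Module.End.eigenspace (φ.baseChange ℂ) (μ k₂)) =>
        UnitaryTheta.apply_mem_eigenspace_of_commute (UnitaryTheta.commute_of_mem_spanC H hφE hcomm hD) hx) = 0 := by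
  classical
  have h := CMThetaKWeil.sum_mul_trace_restrict_eq_zero H hn heff ψ hφE hE μ hinj hdist hrank htop hyskew (fun _ => ν)
    (fun k => hyν k) 𝔤 hcomm hskew hy𝔤 hD
  have huniv : (Finset.univ : Finset ι) = {k₁, k₂} := by
    ext k
    simp only [Finset.mem_univ, Finset.mem_insert, Finset.mem_singleton, true_iff]
    exact hι k
  rw [huniv, Finset.sum_insert (by rw [Finset.mem_singleton]; exact hk), Finset.sum_singleton, ← mul_add] at h
  exact (mul_eq_zero.1 h).resolve_left hν

/-- **`Lie Hg ⊗ ℂ ⊆ 𝔰𝔲_K ⊗ ℂ` FOR A `K`-WEIL CM TYPE WITH TWO PLACES, UNCONDITIONALLY.** `H` effective polarized of weight `1`,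
`E = End_Hdg(V) = ℚ[φ]`, `μ` a CM type with `ι = {k₁, k₂}`, `y ∈ E` `ψ`-skew acting on `W_{μ k₁}` and `W_{μ k₂}` by the same
scalar `ν ≠ 0` (an imaginary quadratic `K = ℚ(y) ⊂ E` whose `ν`-eigenspace is `W_{μ k₁} ⊕ W_{μ k₂}`), and the `K`-WEIL BALANCE
`(dim W_{μ k₁}^{1,0} − dim W_{μ k₁}^{0,1}) + (dim W_{μ k₂}^{1,0} − dim W_{μ k₂}^{0,1}) = 0` (e.g. Hodge types `(2|1)`, `(1|2)`).
Then `tr(D|_{W_{μ k₁}}) + tr(D|_{W_{μ k₂}}) = 0` for every `D ∈ Lie Hg(H) ⊗ ℂ` (§2 + §3).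
[cite: MoonenZarhin1998WeilClasses, §4 Remark (1)] [cite: MoonenZarhin1999LowDim, §3 (3.1) and §2 (2.3)] -/
theorem CMThetaKWeil.trace_restrict_add_eq_zero_of_mem_hodgeLieC [Module.Finite ℚ V] [HodgeTensorFacts.{u, u}] {ι : Type}
    [Fintype ι] [DecidableEq ι] (H : HodgeStructure V n) (hn : n = 1) (heff : H.IsEffective) (ψ : H.Polarization)
    {φ : Module.End ℚ V} (hφE : φ ∈ H.endAlg) {m : ℕ} (hE : ∀ a ∈ H.endAlg, ∃ q : Fin m → ℚ, a = ∑ k, q k • φ ^ (k : ℕ))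
    (μ : ι → ℂ) (hinj : Function.Injective μ) (hdist : ∀ k k', μ k' ≠ starRingEnd ℂ (μ k)) {n₀ : ℕ}
    (hrank : ∀ k, Module.finrank ℂ ↥(Module.End.eigenspace (φ.baseChange ℂ) (μ k) ⊓ H.piece 1 0) +
      Module.finrank ℂ ↥(Module.End.eigenspace (φ.baseChange ℂ) (μ k) ⊓ H.piece 0 1) = n₀)
    (htop : (⨆ kt : ι × Fin 2, Module.End.eigenspace (φ.baseChange ℂ)
      (if kt.2 = 0 then μ kt.1 else starRingEnd ℂ (μ kt.1))) = ⊤)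
    {y : Module.End ℚ V} (hyE : y ∈ H.endAlg) (hyskew : ∀ v w, ψ.form (y v) w + ψ.form v (y w) = 0) {ν : ℂ} (hν : ν ≠ 0)
    (hyν : ∀ k, ∀ w ∈ Module.End.eigenspace (φ.baseChange ℂ) (μ k), y.baseChange ℂ w = ν • w)
    (k₁ k₂ : ι) (hk : k₁ ≠ k₂) (hι : ∀ k, k = k₁ ∨ k = k₂)
    (hbal : ((Module.finrank ℂ ↥(Module.End.eigenspace (φ.baseChange ℂ) (μ k₁) ⊓ H.piece 1 0) : ℤ) -
        Module.finrank ℂ ↥(Module.End.eigenspace (φ.baseChange ℂ) (μ k₁) ⊓ H.piece 0 1)) +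
      ((Module.finrank ℂ ↥(Module.End.eigenspace (φ.baseChange ℂ) (μ k₂) ⊓ H.piece 1 0) : ℤ) -
        Module.finrank ℂ ↥(Module.End.eigenspace (φ.baseChange ℂ) (μ k₂) ⊓ H.piece 0 1)) = 0)
    {D : Module.End ℂ (ℂ ⊗[ℚ] V)} (hD : D ∈ H.hodgeLieC) :
    LinearMap.trace ℂ _ (D.restrict fun x (hx : x ∈ Module.End.eigenspace (φ.baseChange ℂ) (μ k₁)) =>
        UnitaryTheta.apply_mem_eigenspace_of_commute (H.commute_baseChange_of_mem_hodgeLieC hD ⟨φ, hφE⟩) hx) +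
      LinearMap.trace ℂ _ (D.restrict fun x (hx : x ∈ Module.End.eigenspace (φ.baseChange ℂ) (μ k₂)) =>
        UnitaryTheta.apply_mem_eigenspace_of_commute (H.commute_baseChange_of_mem_hodgeLieC hD ⟨φ, hφE⟩) hx) = 0 := by
  classical
  have hbalC : ∑ k, ν * (((Module.finrank ℂ ↥(Module.End.eigenspace (φ.baseChange ℂ) (μ k) ⊓ H.piece 1 0)) : ℂ) -
      (Module.finrank ℂ ↥(Module.End.eigenspace (φ.baseChange ℂ) (μ k) ⊓ H.piece 0 1) : ℂ)) = 0 := by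
    have huniv : (Finset.univ : Finset ι) = {k₁, k₂} := by
      ext k
      simp only [Finset.mem_univ, Finset.mem_insert, Finset.mem_singleton, true_iff]
      exact hι k
    rw [huniv, Finset.sum_insert (by rw [Finset.mem_singleton]; exact hk), Finset.sum_singleton, ← mul_add]
    have h := congrArg (fun z : ℤ => (z : ℂ)) hbal
    simp only [Int.cast_add, Int.cast_sub, Int.cast_natCast, Int.cast_zero] at h
    rw [h, mul_zero]
  have hy𝔤 := CMThetaKWeil.trace_mul_eq_zero_of_mem_hodgeLie H hn heff ψ hφE hE μ hinj hdist hrank htop hyE hyskew (fun _ => ν)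
    hyν hbalC
  exact CMThetaKWeil.trace_restrict_add_eq_zero H hn heff ψ hφE hE μ hinj hdist hrank htop hyskew hν hyν k₁ k₂ hk hι H.hodgeLie
    (fun X hX a => H.commute_of_mem_hodgeLie hX a) (fun X hX => form_apply_add_eq_zero_of_mem_hodgeLie ψ hX) hy𝔤
    ((hodgeLieC_eq_spanC H) ▸ hD)

end HodgeStructure

end Literature.AlgebraicGeometry.Motives

end
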